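import Summits.AtomisticToContinuum.Crystallization.Theorems.ChartedZeroExcessLayeredLatticeLiouvilleZZZYB

/-!
# ChartedZeroExcess · LayeredLatticeLiouville ZZZYD (lens-2 g91 NODE 91 part 2 «WayPoints») — the Euclidean geometry of the routing for the
# kinematic leaf (SC♮′) (PLAN-g91-SC §3 (R1)–(R3), (Z-in); N3 of critic rows 1613/1615/1618), with NO configuration in it: pure facts about `E3`.
* §1 a unit vector orthogonal to a given one (`exists_perp_unit`, by dimension count `1 + dim (ℝu)ᗮ = 3`), and the norm of an orthonormal combination;
* §2 SPHERE WAY-POINTS (`sphere_waypoints`): two points of the sphere of radius `ρ > 0` about `x₀` are joined by `N + 1` points OF THAT SPHERE with consecutive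
  distances `≤ 4ρ/N` — the slerp `x₀ + ρ(cos(jθ/N) û + sin(jθ/N) e)`, `θ = arccos ⟪û, v̂⟫ ≤ π ≤ 4`, chord `≤` arc by `1 − x²/2 ≤ cos x`
  (record use: `ρ = 14`, `N = 280`, spacing `≤ 1/5`);
* §3 RAY WAY-POINTS (`ray_waypoints`): `x₀ + s_j • u`, `s_j = s₀ + j(s₁ − s₀)/50`, spacing `|s₁ − s₀|/50 ≤ 1/5` when `|s₁ − s₀| ≤ 10`, every `s_j` between `s₀` and `s₁`;
* §4 RAY MONOTONICITY (`dist_ray_mono`): for `‖k − x₀‖ ≤ 4`, `s ↦ dist (x₀ + s • u) k` is non-decreasing on `s ≥ 4` (`(s′ − s)(s′ + s − 2⟪u, k − x₀⟫) ≥ 0`), hence on a ray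
  segment beyond `4` the distance to `k` lies between its end values (`dist_ray_between`);
* §5 THE OUTWARD PUSH of (Z-in) (`outward_push`): if `‖k − x₀‖ ≤ 4` and `dist p k > 8` then `z := p + 3u_p` (`u_p` the unit of `p − x₀`) has `dist z k² > 114`
  (`> 10.67²`; MARGIN `114 − 113.85`) and `dist z k ≤ dist p k + 3`, `dist z p = 3` — with `a := ⟪p − k, u_p⟫`: `dist z k² = dist p k² + 6a + 9`, `a² ≥ dist p k² − 16 > 48`.
0 sorry · import = tree ZZZYB only (independent of NODE 91a) · 0 defs · no instances/notation/options · axioms standard. [g91]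
-/

noncomputable section

open scoped BigOperators RealInnerProductSpace
open MeasureTheory Set Metric Filter Topology
open Summit.AtomisticToContinuum.Crystallization.Theorems.ChartedPlanarOrderRigidityDoor (E3)

namespace Summit.AtomisticToContinuum.Crystallization.Theorems.ChartedZeroExcessLayeredLatticeLiouville

/-! ### ZZZYD-1  orthogonal unit vectors -/

section Ortho

/-- a unit vector orthogonal to any given vector of `E3` (PROVED: `dim (ℝu)ᗮ = 2 > 0` for `u ≠ 0`; for `u = 0` the first canonical-triple vector). [g91] -/
theorem exists_perp_unit (u : E3) : ∃ e : E3, ‖e‖ = 1 ∧ ⟪u, e⟫ = 0 := by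
  by_cases hu : u = 0
  · exact ⟨canonTriple 0, norm_canonTriple 0, by rw [hu, inner_zero_left]⟩
  · have h3 : Module.finrank ℝ E3 = 3 := finrank_euclideanSpace_fin
    have h1 : Module.finrank ℝ (ℝ ∙ u) = 1 := finrank_span_singleton hu
    have hsum := Submodule.finrank_add_finrank_orthogonal (ℝ ∙ u)
    have hpos : 0 < Module.finrank ℝ (ℝ ∙ u)ᗮ := by omega
    obtain ⟨v, hv⟩ := Module.finrank_pos_iff_exists_ne_zero.1 hpos
    have hv0 : (v : E3) ≠ 0 := fun h => hv (Subtype.ext h)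
    have hvu : ⟪u, (v : E3)⟫ = 0 := (Submodule.mem_orthogonal_singleton_iff_inner_right).1 v.2
    refine ⟨(‖(v : E3)‖⁻¹ : ℝ) • (v : E3), norm_smul_inv_norm hv0, ?_⟩
    rw [real_inner_smul_right, hvu, mul_zero]

/-- the norm of an orthonormal combination: `‖a • u + b • e‖² = a² + b²` for unit `u ⟂ e`. [g91] -/
theorem norm_sq_orthoComb {u e : E3} (hu : ‖u‖ = 1) (he : ‖e‖ = 1) (hue : ⟪u, e⟫ = 0) (a b : ℝ) : ‖a • u + b • e‖ ^ 2 = a ^ 2 + b ^ 2 := by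
  rw [norm_add_sq_real, norm_smul, norm_smul, hu, he, real_inner_smul_left, real_inner_smul_right, hue, Real.norm_eq_abs, Real.norm_eq_abs,
    mul_one, mul_one, sq_abs, sq_abs]
  ring

/-- the chord of the unit circle is at most the arc: `(cos a − cos b)² + (sin a − sin b)² ≤ (a − b)²` (`= 2 − 2cos(a − b)`, `1 − x²/2 ≤ cos x`). [g91] -/
theorem chord_sq_le (a b : ℝ) : (Real.cos a - Real.cos b) ^ 2 + (Real.sin a - Real.sin b) ^ 2 ≤ (a - b) ^ 2 := by
  have h1 : (Real.cos a - Real.cos b) ^ 2 + (Real.sin a - Real.sin b) ^ 2 = 2 - 2 * Real.cos (a - b) := by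
    rw [Real.cos_sub]; nlinarith [Real.sin_sq_add_cos_sq a, Real.sin_sq_add_cos_sq b]
  rw [h1]
  linarith [Real.one_sub_sq_div_two_le_cos (x := a - b)]

end Ortho

/-! ### ZZZYD-2  sphere way-points (slerp) -/

section Sphere

/-- ★★ SPHERE WAY-POINTS (PROVED): two points `P, T` of the sphere of radius `ρ > 0` about `x₀` are joined, for every `N > 0`, by points `w 0 = P, …, w N = T`
ALL ON THAT SPHERE with `dist (w (j+1)) (w j) ≤ 4ρ/N` — the spherical interpolation through the great circle of `P` and `T`
(`û ∥ P − x₀`, `e ⟂ û` in the plane of `T − x₀`, angle `θ = arccos ⟪û, v̂⟫ ∈ [0, π]`, `π ≤ 4`). [g91] -/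
theorem sphere_waypoints (x₀ : E3) {ρ : ℝ} (hρ : 0 < ρ) {P T : E3} (hP : dist P x₀ = ρ) (hT : dist T x₀ = ρ) {N : ℕ} (hN : 0 < N) :
    ∃ w : ℕ → E3, w 0 = P ∧ w N = T ∧ (∀ j, dist (w j) x₀ = ρ) ∧ ∀ j, dist (w (j + 1)) (w j) ≤ 4 * ρ / N := by
  have hρ0 : ρ ≠ 0 := hρ.ne'
  obtain ⟨u, hu_def⟩ : ∃ u : E3, u = ρ⁻¹ • (P - x₀) := ⟨_, rfl⟩
  obtain ⟨v, hv_def⟩ : ∃ v : E3, v = ρ⁻¹ • (T - x₀) := ⟨_, rfl⟩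
  have hu : ‖u‖ = 1 := by rw [hu_def, norm_smul, norm_inv, Real.norm_of_nonneg hρ.le, ← dist_eq_norm, hP, inv_mul_cancel₀ hρ0]
  have hv : ‖v‖ = 1 := by rw [hv_def, norm_smul, norm_inv, Real.norm_of_nonneg hρ.le, ← dist_eq_norm, hT, inv_mul_cancel₀ hρ0]
  have hPu : P = x₀ + ρ • u := by rw [hu_def, smul_smul, mul_inv_cancel₀ hρ0, one_smul]; abel
  have hTv : T = x₀ + ρ • v := by rw [hv_def, smul_smul, mul_inv_cancel₀ hρ0, one_smul]; abel
  obtain ⟨c, hc_def⟩ : ∃ c : ℝ, c = ⟪u, v⟫ := ⟨_, rfl⟩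
  have hc1 : |c| ≤ 1 := by have := abs_real_inner_le_norm u v; rw [hu, hv, mul_one, ← hc_def] at this; exact this
  obtain ⟨h, hh_def⟩ : ∃ h : E3, h = v - c • u := ⟨_, rfl⟩
  have huh : ⟪u, h⟫ = 0 := by
    rw [hh_def, inner_sub_right, real_inner_smul_right, real_inner_self_eq_norm_sq, hu, ← hc_def]; ring
  have hh2 : ‖h‖ ^ 2 = 1 - c ^ 2 := by
    have e : v = c • u + h := by rw [hh_def]; abel
    have := norm_add_sq_real (c • u) h
    rw [← e, hv, norm_smul, hu, mul_one, Real.norm_eq_abs, sq_abs, real_inner_smul_left, huh, mul_zero] at this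
    linarith
  -- the second orthonormal vector `e` with `v = c • u + ‖h‖ • e`
  obtain ⟨e, he, hue, hve⟩ : ∃ e : E3, ‖e‖ = 1 ∧ ⟪u, e⟫ = 0 ∧ v = c • u + ‖h‖ • e := by
    by_cases h0 : h = 0
    · obtain ⟨e, he, hue⟩ := exists_perp_unit u
      refine ⟨e, he, hue, ?_⟩
      rw [h0, norm_zero, zero_smul, add_zero]
      have : v - c • u = 0 := by rw [← hh_def]; exact h0
      exact (sub_eq_zero.1 this)
    · refine ⟨(‖h‖⁻¹ : ℝ) • h, norm_smul_inv_norm h0, by rw [real_inner_smul_right, huh, mul_zero], ?_⟩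
      rw [smul_smul, mul_inv_cancel₀ (norm_ne_zero_iff.2 h0), one_smul, hh_def]; abel
  obtain ⟨θ, hθ_def⟩ : ∃ θ : ℝ, θ = Real.arccos c := ⟨_, rfl⟩
  have hcos : Real.cos θ = c := by rw [hθ_def]; exact Real.cos_arccos (abs_le.1 hc1).1 (abs_le.1 hc1).2
  have hsin : Real.sin θ = ‖h‖ := by
    rw [hθ_def, Real.sin_arccos, ← hh2, Real.sqrt_sq (norm_nonneg h)]
  have hθ0 : 0 ≤ θ := by rw [hθ_def]; exact Real.arccos_nonneg c
  have hθ4 : θ ≤ 4 := by rw [hθ_def]; exact (Real.arccos_le_pi c).trans Real.pi_le_four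
  have hN0 : (0 : ℝ) < N := by exact_mod_cast hN
  refine ⟨fun j => x₀ + ρ • (Real.cos (j * θ / N) • u + Real.sin (j * θ / N) • e), ?_, ?_, fun j => ?_, fun j => ?_⟩
  · show x₀ + ρ • (Real.cos ((0 : ℕ) * θ / N) • u + Real.sin ((0 : ℕ) * θ / N) • e) = P
    rw [Nat.cast_zero, zero_mul, zero_div, Real.cos_zero, Real.sin_zero, one_smul, zero_smul, add_zero]
    exact hPu.symm
  · show x₀ + ρ • (Real.cos ((N : ℕ) * θ / N) • u + Real.sin ((N : ℕ) * θ / N) • e) = T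
    have hNθ : (N : ℝ) * θ / N = θ := by field_simp
    rw [hNθ, hcos, hsin, ← hve]
    exact hTv.symm
  · show dist (x₀ + ρ • (Real.cos (j * θ / N) • u + Real.sin (j * θ / N) • e)) x₀ = ρ
    have hn : ‖Real.cos (j * θ / N) • u + Real.sin (j * θ / N) • e‖ = 1 := by
      have hsq := norm_sq_orthoComb hu he hue (Real.cos (j * θ / N)) (Real.sin (j * θ / N))
      rw [Real.cos_sq_add_sin_sq] at hsq
      have h0 : 0 ≤ ‖Real.cos (j * θ / N) • u + Real.sin (j * θ / N) • e‖ := norm_nonneg _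
      nlinarith
    rw [dist_eq_norm, add_sub_cancel_left, norm_smul, hn, mul_one, Real.norm_of_nonneg hρ.le]
  · obtain ⟨a, ha⟩ : ∃ a : ℝ, a = (j + 1 : ℕ) * θ / N := ⟨_, rfl⟩
    obtain ⟨b, hb⟩ : ∃ b : ℝ, b = (j : ℕ) * θ / N := ⟨_, rfl⟩
    show dist (x₀ + ρ • (Real.cos ((j + 1 : ℕ) * θ / N) • u + Real.sin ((j + 1 : ℕ) * θ / N) • e))
      (x₀ + ρ • (Real.cos ((j : ℕ) * θ / N) • u + Real.sin ((j : ℕ) * θ / N) • e)) ≤ 4 * ρ / N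
    rw [← ha, ← hb]
    have hab : a - b = θ / N := by rw [ha, hb]; push_cast; ring
    have e1 : x₀ + ρ • (Real.cos a • u + Real.sin a • e) - (x₀ + ρ • (Real.cos b • u + Real.sin b • e)) =
        ρ • ((Real.cos a - Real.cos b) • u + (Real.sin a - Real.sin b) • e) := by
      simp only [smul_add, smul_sub, sub_smul]; abel
    rw [dist_eq_norm, e1, norm_smul, Real.norm_of_nonneg hρ.le]
    have hsq := norm_sq_orthoComb hu he hue (Real.cos a - Real.cos b) (Real.sin a - Real.sin b)
    have hch := chord_sq_le a b
    rw [hab] at hch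
    have hθN : 0 ≤ θ / N := div_nonneg hθ0 hN0.le
    have hnn : 0 ≤ ‖(Real.cos a - Real.cos b) • u + (Real.sin a - Real.sin b) • e‖ := norm_nonneg _
    have hle : ‖(Real.cos a - Real.cos b) • u + (Real.sin a - Real.sin b) • e‖ ≤ θ / N := by nlinarith
    calc ρ * ‖(Real.cos a - Real.cos b) • u + (Real.sin a - Real.sin b) • e‖ ≤ ρ * (θ / N) := mul_le_mul_of_nonneg_left hle hρ.le
      _ ≤ ρ * (4 / N) := mul_le_mul_of_nonneg_left (div_le_div_of_nonneg_right hθ4 hN0.le) hρ.le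
      _ = 4 * ρ / N := by ring

end Sphere

/-! ### ZZZYD-3  ray way-points and ray monotonicity -/

section Ray

/-- RAY WAY-POINTS (PROVED): on the ray `x₀ + s • u` (`‖u‖ = 1`) the `51` points `s_j = s₀ + j(s₁ − s₀)/50` go from `s₀` to `s₁` with spacing `|s₁ − s₀|/50 ≤ 1/5`
when `|s₁ − s₀| ≤ 10`, and every `s_j`, `j ≤ 50`, lies between `s₀` and `s₁`. [g91] -/
theorem ray_waypoints (x₀ u : E3) (hu : ‖u‖ = 1) {s₀ s₁ : ℝ} (hs : |s₁ - s₀| ≤ 10) :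
    ∃ w : ℕ → E3, ∃ σ : ℕ → ℝ, (∀ j, w j = x₀ + σ j • u) ∧ σ 0 = s₀ ∧ σ 50 = s₁ ∧
      (∀ j, j ≤ 50 → min s₀ s₁ ≤ σ j ∧ σ j ≤ max s₀ s₁) ∧ ∀ j, dist (w (j + 1)) (w j) ≤ 1 / 5 := by
  refine ⟨fun j => x₀ + (s₀ + j * (s₁ - s₀) / 50) • u, fun j => s₀ + j * (s₁ - s₀) / 50, fun j => rfl, by simp, by push_cast; ring,
    fun j hj => ?_, fun j => ?_⟩
  · have hj' : (j : ℝ) ≤ 50 := by exact_mod_cast hj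
    have hj0 : (0 : ℝ) ≤ j := Nat.cast_nonneg j
    constructor
    · rcases le_total s₀ s₁ with hle | hle
      · rw [min_eq_left hle]; nlinarith
      · rw [min_eq_right hle]; nlinarith
    · rcases le_total s₀ s₁ with hle | hle
      · rw [max_eq_right hle]; nlinarith
      · rw [max_eq_left hle]; nlinarith
  · have hσ : (s₀ + ((j + 1 : ℕ) : ℝ) * (s₁ - s₀) / 50) = (s₀ + (j : ℕ) * (s₁ - s₀) / 50) + (s₁ - s₀) / 50 := by push_cast; ring
    have e1 : x₀ + (s₀ + ((j + 1 : ℕ) : ℝ) * (s₁ - s₀) / 50) • u - (x₀ + (s₀ + (j : ℕ) * (s₁ - s₀) / 50) • u) = ((s₁ - s₀) / 50) • u := by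
      rw [hσ, add_smul]; abel
    rw [dist_eq_norm, e1, norm_smul, hu, mul_one, Real.norm_eq_abs, abs_div, abs_of_pos (by norm_num : (0 : ℝ) < 50)]
    linarith

/-- the squared distance along a ray: `dist (x₀ + s • u) k² = s² − 2s⟪u, k − x₀⟫ + ‖k − x₀‖²` (`‖u‖ = 1`). [g91] -/
theorem dist_ray_sq (x₀ u k : E3) (hu : ‖u‖ = 1) (s : ℝ) : dist (x₀ + s • u) k ^ 2 = s ^ 2 - 2 * s * ⟪u, k - x₀⟫ + ‖k - x₀‖ ^ 2 := by
  have e : x₀ + s • u - k = s • u - (k - x₀) := by abel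
  rw [dist_eq_norm, e, norm_sub_sq_real, norm_smul, hu, mul_one, Real.norm_eq_abs, sq_abs, real_inner_smul_left]; ring

/-- ★ RAY MONOTONICITY (PROVED): for a container atom `k` with `dist k x₀ ≤ 4`, the distance `dist (x₀ + s • u) k` is non-decreasing in `s` on `s ≥ 4`
(the level function `Φ = min_k dist(·, k)` therefore lies between its end values along any ray segment beyond radius `4`). [g91] -/
theorem dist_ray_mono {x₀ u k : E3} (hu : ‖u‖ = 1) (hk : dist k x₀ ≤ 4) {s s' : ℝ} (hs : 4 ≤ s) (hss' : s ≤ s') :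
    dist (x₀ + s • u) k ≤ dist (x₀ + s' • u) k := by
  have hc : ⟪u, k - x₀⟫ ≤ 4 := by
    have h1 := abs_real_inner_le_norm u (k - x₀)
    rw [hu, one_mul, ← dist_eq_norm] at h1
    exact ((le_abs_self _).trans h1).trans hk
  refine le_of_pow_le_pow_left₀ two_ne_zero dist_nonneg ?_
  rw [dist_ray_sq x₀ u k hu s, dist_ray_sq x₀ u k hu s']
  nlinarith [mul_nonneg (sub_nonneg.2 hss') (show 0 ≤ s' + s - 2 * ⟪u, k - x₀⟫ by linarith)]

/-- on a ray segment beyond radius `4` the distance to a container atom lies between its two end values. [g91] -/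
theorem dist_ray_between {x₀ u k : E3} (hu : ‖u‖ = 1) (hk : dist k x₀ ≤ 4) {s₀ s₁ s : ℝ} (h₀ : 4 ≤ s₀) (h₁ : 4 ≤ s₁) (hlo : min s₀ s₁ ≤ s)
    (hhi : s ≤ max s₀ s₁) :
    min (dist (x₀ + s₀ • u) k) (dist (x₀ + s₁ • u) k) ≤ dist (x₀ + s • u) k ∧
      dist (x₀ + s • u) k ≤ max (dist (x₀ + s₀ • u) k) (dist (x₀ + s₁ • u) k) := by
  rcases le_total s₀ s₁ with hle | hle
  · rw [min_eq_left hle] at hlo; rw [max_eq_right hle] at hhi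
    exact ⟨(min_le_left _ _).trans (dist_ray_mono hu hk h₀ hlo), (dist_ray_mono hu hk (h₀.trans hlo) hhi).trans (le_max_right _ _)⟩
  · rw [min_eq_right hle] at hlo; rw [max_eq_left hle] at hhi
    exact ⟨(min_le_right _ _).trans (dist_ray_mono hu hk h₁ hlo), (dist_ray_mono hu hk (h₁.trans hlo) hhi).trans (le_max_left _ _)⟩

end Ray

/-! ### ZZZYD-4  the outward push of (Z-in) -/

section Push

/-- ★ THE OUTWARD PUSH (PROVED): a point `p` farther than `8` from a container atom `k` (`dist k x₀ ≤ 4`) pushed by `3` along its own ray from `x₀` lands at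
`z := p + 3 • u_p` with `dist z k² > 114` (so `dist z k > 10.67`) and `dist z k ≤ dist p k + 3`; `z` does not depend on `k` and `dist z p = 3`.
With `r = dist p x₀ (> 4)`, `c = ⟪u_p, k − x₀⟫ ≤ 4`, `m = ‖k − x₀‖ ≤ 4`: `dist p k² = r² − 2rc + m² > 64`, `a := r − c > 0`, `a² = dist p k² − m² + c² ≥ dist p k² − 16 > 48`,
`dist z k² = dist p k² + 6a + 9 > 64 + 41 + 9`. [g91] -/
theorem outward_push (x₀ p : E3) (hp : 4 < dist p x₀) : ∃ z : E3, dist z p = 3 ∧ ∀ k : E3, dist k x₀ ≤ 4 → 8 < dist p k →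
    114 < dist z k ^ 2 ∧ dist z k ≤ dist p k + 3 := by
  set r : ℝ := dist p x₀ with hr
  have hr0 : 0 < r := by linarith
  obtain ⟨u, hu_def⟩ : ∃ u : E3, u = r⁻¹ • (p - x₀) := ⟨_, rfl⟩
  have hu : ‖u‖ = 1 := by
    rw [hu_def, norm_smul, norm_inv, Real.norm_of_nonneg hr0.le, ← dist_eq_norm, ← hr, inv_mul_cancel₀ hr0.ne']
  have hpu : p = x₀ + r • u := by rw [hu_def, smul_smul, mul_inv_cancel₀ hr0.ne', one_smul]; abel
  refine ⟨x₀ + (r + 3) • u, ?_, fun k hk hpk => ?_⟩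
  · have e : x₀ + (r + 3) • u - p = (3 : ℝ) • u := by rw [hpu, add_smul]; abel
    rw [dist_eq_norm, e, norm_smul, hu, mul_one, Real.norm_of_nonneg (by norm_num : (0 : ℝ) ≤ 3)]
  · have hc : ⟪u, k - x₀⟫ ≤ 4 := by
      have h1 := abs_real_inner_le_norm u (k - x₀)
      rw [hu, one_mul, ← dist_eq_norm] at h1
      exact ((le_abs_self _).trans h1).trans hk
    have hc' : ⟪u, k - x₀⟫ ^ 2 ≤ ‖k - x₀‖ ^ 2 := by
      have h1 := abs_real_inner_le_norm u (k - x₀)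
      rw [hu, one_mul] at h1
      exact (sq_abs ⟪u, k - x₀⟫) ▸ pow_le_pow_left₀ (abs_nonneg _) h1 2
    have hm : ‖k - x₀‖ ≤ 4 := by rw [← dist_eq_norm]; exact hk
    have hD : dist p k ^ 2 = r ^ 2 - 2 * r * ⟪u, k - x₀⟫ + ‖k - x₀‖ ^ 2 := by rw [hpu]; exact dist_ray_sq x₀ u k hu r
    have hZ : dist (x₀ + (r + 3) • u) k ^ 2 = (r + 3) ^ 2 - 2 * (r + 3) * ⟪u, k - x₀⟫ + ‖k - x₀‖ ^ 2 := dist_ray_sq x₀ u k hu (r + 3)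
    have hm2 : ‖k - x₀‖ ^ 2 ≤ 16 := by nlinarith [norm_nonneg (k - x₀)]
    have ha_sq : (r - ⟪u, k - x₀⟫) ^ 2 = dist p k ^ 2 - ‖k - x₀‖ ^ 2 + ⟪u, k - x₀⟫ ^ 2 := by rw [hD]; ring
    have hZ' : dist (x₀ + (r + 3) • u) k ^ 2 = dist p k ^ 2 + 6 * (r - ⟪u, k - x₀⟫) + 9 := by rw [hZ, hD]; ring
    have hD8 : 64 < dist p k ^ 2 := by
      have := mul_lt_mul'' hpk hpk (by norm_num) (by norm_num)
      nlinarith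
    have ha0 : 0 < r - ⟪u, k - x₀⟫ := by linarith
    have ha2 : 48 < (r - ⟪u, k - x₀⟫) ^ 2 := by rw [ha_sq]; nlinarith [sq_nonneg ⟪u, k - x₀⟫]
    have ha : 41 / 6 < r - ⟪u, k - x₀⟫ := by
      by_contra hle
      rw [not_lt] at hle
      have h2 := mul_le_mul hle hle ha0.le (by norm_num : (0 : ℝ) ≤ 41 / 6)
      nlinarith
    have haD : r - ⟪u, k - x₀⟫ ≤ dist p k := by
      refine le_of_pow_le_pow_left₀ two_ne_zero dist_nonneg ?_
      rw [ha_sq]; nlinarith [hc']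
    refine ⟨by rw [hZ']; linarith, ?_⟩
    refine le_of_pow_le_pow_left₀ two_ne_zero (by linarith [dist_nonneg (x := p) (y := k)]) ?_
    rw [hZ']
    nlinarith [haD, dist_nonneg (x := p) (y := k)]

end Push

end Summit.AtomisticToContinuum.Crystallization.Theorems.ChartedZeroExcessLayeredLatticeLiouville

end
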